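import Mathlib.Analysis.SpecialFunctions.Log.Basic
import Mathlib.Analysis.SpecialFunctions.Pow.Real
import Literature.Geometry.Lorentzian.TrappedSurface
import Literature.Geometry.Lorentzian.CauchyDevelopment
import Literature.Geometry.Lorentzian.KerrConvergence
import Literature.Geometry.Lorentzian.WeightedNorms
import HarnessLib

/-!
# Formation events of black holes along a Cauchy time function; ancient-in-scale formations

Vocabulary requested by the route `CriticalAncestry` of the final state conjecture (idea card
*small-holes-have-critical-ancestry*, item D1; definition item `defn-IsAncientInScaleFormation`)
for its crux `FiniteCensus` and the planned splits K1 (ancient-in-scale compactness), K2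
(impulsive-or-conical dichotomy), K3 (no cascade). Everything here is a DEFINITION (no named
fact is introduced): the printed sources fix the ingredients, the card fixes how they are
assembled, and the assembled notions `IsFormationEvent`, `formationDepth`,
`IsAncientInScaleFormation` are *objects posited by that card*, not restatements of theorems.

## Contents (namespace `Literature.Geometry.Lorentzian`)

* **Data side** (smooth initial data `(X, h, k)` on a boundaryless `3`-manifold).
  `BoundingSurface h Ω`: a compact smoothly embedded surface which is the topological boundary
  of the open precompact region `Ω` ("the inside"), with a SMOOTH unit normal pointing out of
  `Ω` (Andersson–Metzger, CMP 290 (2009) = arXiv:0708.4252, Def. 2.2 "`Σ` bounds a region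
  `Ω`", Def. 7.1; smoothness of the normal is demanded because a bare `NormalField`
  constrained pointwise may flip sign and make `θ⁺` a junk value, cf. the section "corrected
  statement" of `OutermostHorizon.lean`); `surfaceArea`; `mass := √(|S|/16π)`.
  `IsWeaklyOuterTrappedSet h k Ω` (Def. 7.1: `θ⁺[∂Ω] ≤ 0` for the normal pointing out of `Ω`),
  `trappedRegion h k := ⋃ {Ω | weakly outer trapped}` (Def. 7.2, the trapped region `T`, whose
  boundary is the smooth outermost MOTS, Thm. 7.3), `BoundingMOTS h k` (Def. 2.1–2.2: a MOTS,
  `θ⁺ = 0`, bounding an inside region), `formationDepth L S := log (L / m_S)`.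
* **Spacetime side** (`𝓢 : Spacetime 4`). `CauchyLeaf 𝓢`: a spacelike Cauchy hypersurface of
  `𝓢` presented with its induced data — literally the fields of `CauchyDevelopment` (Ringström
  2009, Def. 16.2) re-parametrised by the ambient spacetime instead of by the data, with the
  conversions `CauchyLeaf.toCauchyDevelopment` (`toSpacetime = 𝓢` by `rfl`: the rendering
  "`𝒟'.toSpacetime = 𝒟.toSpacetime`" of a Cauchy slice used by `FiniteCensus`) and
  `CauchyLeaf.ofCauchyDevelopment`. `CauchyTimeFunction 𝓢`: a smooth function strictly
  increasing along future-directed causal curves all of whose level sets are Cauchy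
  hypersurfaces, each level presented as a `CauchyLeaf` (Bernal–Sánchez, Lett. Math. Phys. 77
  (2006), §2: "time function", "Cauchy if its levels are Cauchy hypersurfaces", "assumed onto").
* **Formation events** (card D1 (1)–(2)). `IsFormationEvent T t₀ S`: along the Cauchy time
  function `T`, the connected MOTS `S` of the leaf `{T = t₀}` lies in the boundary of the
  trapped region of its leaf (it is a component of the outermost MOTS, AM 2009, Thm. 7.3) and
  is NEWLY BORN: its image meets neither the closure of the trapped world-region
  `⋃_{t<t₀} ι_t(T_t)` of the earlier leaves (continuity form) nor the causal future `J⁺` of the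
  trapped region of any earlier leaf (the card's clause — which, by Andersson–Mars–Metzger–Simon
  2009, Thm. 3.1, holds for EVERY outermost MOTS under the null energy condition, whence the
  continuity form). Mass `m_S = S.mass`, depth `formationDepth L S` for an ambient scale `L > 0`
  supplied by the user (the harmonic-radius scale of the card is not constructed here; two
  reasonable choices differ by a datum-dependent factor).
* **Ancient-in-scale formations** (card D1 (3): "the would-be limits of `(J⁻(S_n), m_n⁻² g)`
  along formation events of depth `→ ∞`"). `FormationGerm`: a spacetime with a Cauchy time
  function, a MOTS `S̄` of the leaf `{T = 0}` bounding an inside region, and a gauge chart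
  `Ψ : U → 𝓜`, `U ⊆ E4` open. `IsAncientInScaleFormationWith k α Λ ε₀ 𝓐`: vacuum; globally
  hyperbolic; `S̄` connected of area `16π` ("unit black hole", `m_{S̄} = 1`); `Ψ` a smooth
  embedding with open range whose coordinate time is `T`, covering `J⁻(S̄)`, with `S̄` in the
  coordinate ball of radius `Λ`; on `V := Ψ⁻¹(J⁻(S̄))` the pulled-back metric is uniformly
  non-degenerate (`g(∂₀,∂₀) ≤ -Λ⁻¹`, `g(v,v) ≥ Λ⁻¹|v|²` for spatial `v`), obeys the
  SCALE-INVARIANT `C^{k,α}` bound `sup_V (1+|x|)^m |D^m(Ψ^*g − η)| ≤ Λ`, `m ≤ k`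
  (`weightedCkSeminorm V k 0` of `WeightedNorms.lean`) with the scale-invariant local `α`-Hölder
  bound on `D^k` — "constants independent of the scale" — and is scale-invariantly NON-SMALL
  on every dyadic shell, `sup_{V ∩ {ℓ ≤ 1+|x| ≤ 2ℓ}} (1+|x|) |D(Ψ^*g − η)| ≥ ε₀` for every
  `ℓ ≥ 1` (`weightedDerivSup`). `IsAncientInScaleFormation k α 𝓐 := ∃ Λ ε₀, …`.

## Design choices and what is deliberately NOT here

* *Chart-level consequence form.* The card asks for "scale-invariant `H²/C^{1,α}` curvature
  bounds (Klainerman–Rodnianski–Szeftel level)" and "a localised Christodoulou–Klainerman/Bieri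
  smallness functional `≥ ε₀`". As in `KerrConvergence.lean` (whose module docstring explains
  why gauge machinery is replaced by sup norms of `Ψ^* g − g₀` in a chart), both are rendered
  by weighted sup norms of the metric deviation in the gauge chart: the weight `(1+|x|)^m` on
  the `m`-th derivative makes the seminorm invariant under `x ↦ cx` (the rescalings `m_n⁻² g`
  read in coordinates `x/m_n`), so ONE constant serves every scale — the "ancient in scale"
  content. `(k, α) = (1, α)` is the `C^{1,α}` level of the card; `(1, 0)` (scale-invariantly
  Lipschitz metric) still admits IMPULSIVE pasts — for Christodoulou's short pulse
  (Christodoulou 2009, Ch. 2) `(1+|x|)|∂g| ∼ |u| |χ̂| ∼ δ^{-1/2}` stays bounded and bounded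
  below at every scale while `(1+|x|)²|∂²g|` does not — whereas `k = 2` is scale-invariantly
  bounded curvature, met by (asymptotically) self-similar pasts. `L²`-based (`H²`,
  curvature-flux) control, and the pointed `H²/C^{1,α}` convergence of developments under which
  such objects are to ARISE (card K1, P3), are NOT defined here; no existence statement is made.
* *Non-smallness is measured by first derivatives only* (the scale-invariant size of the
  connection coefficients, the level of An–Luk's scale-critical short-pulse norms, An–Luk 2017,
  §1) on dyadic shells of the chart: a constant rescaling `g = c η` of Minkowski space is not
  "non-small", and the clause forces `Ψ⁻¹(J⁻(S̄))` to meet every shell, i.e. the past to exist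
  out to every scale (`IsAncientInScaleFormationWith.exists_mem_pastCoords`). It is a lower
  bound in the chart supplied as a field — gauge-dependent, exactly as the card's "(measured in
  the foliation/gauge supplied as a field)"; for `k ≥ 1` it forces `ε₀ ≤ Λ` (`ε₀_le`).
* *The trapped region for boundaryless one-ended data.* Andersson–Metzger work on a compact `M`
  with outer barrier boundary `∂⁺M` and inner boundary `∂⁻M`; "`Σ` bounds `Ω` with respect to
  `∂⁺M`" becomes: `Ω` is open and precompact in the boundaryless `X` with `frontier Ω = Σ` (for
  the complete one-ended data of the admissible class the inside of a closed surface is the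
  precompact side). Without precompactness every small round sphere, taken with its inward
  normal as "outward", would be weakly outer trapped and `trappedRegion` would be everything.
  The surface type of a `BoundingSurface` may be empty (then `Ω` is clopen and precompact);
  formation events and unit holes are required connected, hence nonempty.
* *Leaves are presented, not derived.* A `CauchyTimeFunction` carries each level `{T = t}` as a
  `CauchyLeaf` (a `3`-manifold `slice` with data `(h, k)` embedded onto the level with
  `ι^* g = h`, `K_ν = k`), because the MOTS vocabulary of `TrappedSurface.lean` is phrased over
  data sets; ontoness of `T` (Bernal–Sánchez: "assumed onto without loss of generality") is then
  automatic (`CauchyTimeFunction.time_surjective`). The standing Levi-Civita hypothesis of a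
  data metric (which holds outright, `PseudoRiemannianMetric.hasLeviCivita` of
  `LeviCivitaProofs.lean`, not imported here) is bound innermost in the `Prop`s that need it
  (`∀ [HasLeviCivita], …`, as in `DataEmbedding.IsVacuum`), so no structure takes it as a
  parameter.
* Mathlib has none of: MOTS, trapped regions, Cauchy time functions, developments
  (`rg -i "trapped|time function" Mathlib/Geometry` is empty); used are
  `Manifold.IsSmoothEmbedding`, `TopologicalSpace.Opens`, `frontier`, `iteratedFDeriv`,
  `Real.log/sqrt/rpow`, `ℝ≥0∞`.

## References

* L. Andersson, J. Metzger, *The area of horizons and the trapped region*, Comm. Math. Phys.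
  290 (2009) 941–972 = arXiv:0708.4252: Def. 2.1–2.3 (MOTS, bounding, outermost), Def. 7.1–7.2
  (weakly outer trapped sets, the trapped region `T`), Thm. 7.3 (`∂⁺T` is a smooth stable
  MOTS).
* L. Andersson, M. Mars, J. Metzger, W. Simon, *The time evolution of marginally trapped
  surfaces*, Class. Quantum Grav. 26 (2009) 085018 = arXiv:0811.4721: Thm. 3.1
  (`J⁺(T₀) ∩ M_t ⊆ T_t`; outermost MOTTs are achronal), §4–§6 (jumps of the outermost MOTS).
* A. N. Bernal, M. Sánchez, *Further results on the smoothability of Cauchy hypersurfaces and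
  Cauchy time functions*, Lett. Math. Phys. 77 (2006) 183–197, §2 (time/temporal/Cauchy time
  functions), Thm. 1.2 (every spacelike Cauchy hypersurface is a level of a Cauchy temporal
  function).
* H. Ringström, *The Cauchy Problem in General Relativity*, EMS 2009, Def. 16.2 (developments).
* S. Klainerman, I. Rodnianski, J. Szeftel, *The bounded `L²` curvature conjecture*, Invent.
  Math. 202 (2015) 91–216, Thm. 2.2 and §2.4 (the `H²` level of control).
* D. Christodoulou, *The Formation of Black Holes in General Relativity*, EMS 2009, Ch. 2
  (short pulse data); X. An, J. Luk, *Trapped surfaces in vacuum arising dynamically from mild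
  incoming radiation*, Adv. Theor. Math. Phys. 21 (2017), §1 (scale-critical norms).
* D. Christodoulou, S. Klainerman, *The global nonlinear stability of the Minkowski space*,
  1993, §1 (global smallness assumption; weighted norms (1.0.9)).
* G. Perelman, arXiv:math/0211159, §11 (ancient `κ`-solutions — the template for "ancient in
  scale").
-/

noncomputable section

open Bundle Set Manifold TopologicalSpace Filter
open scoped ContDiff Topology ENNReal Manifold Real

universe u

namespace Literature.Geometry.Lorentzian

open PseudoRiemannianMetric

/-! ### Data side: surfaces bounding a region; weakly outer trapped sets; the trapped region -/

section Data

variable {X : Type*} [TopologicalSpace X] [ChartedSpace E3 X] [IsManifold (𝓡 3) ∞ X]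

/-- A **surface bounding the region `Ω`** in the smooth Riemannian `3`-manifold `(X, h)`
(Andersson–Metzger, CMP 290 (2009), Def. 2.2 "`Σ` bounds a region `Ω`", and Def. 7.1, adapted to
a boundaryless ambient manifold, see the module docstring): a compact Hausdorff surface type
`surf` (with its Borel structure, for areas), smoothly embedded by `f` as a spacelike (i.e.
Riemannian) immersion whose image is the topological boundary of the OPEN, PRECOMPACT region `Ω`
("the inside"), together with a unit normal field `ν` along `f` which is smooth as a map into `TX`
and points OUT of `Ω` (the chart-straight curve with velocity `ν y` leaves `closure Ω` for small
`t > 0`; this is the "outer normal" of Def. 2.2). Bracketed fields are instances; `hpb` is the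
pullback-smoothness fact of `Isometry.lean` needed to form the induced metric. The surface type
may be empty (then `Ω`, being clopen and precompact, is empty or all of a compact `X`).
[cite: AnderssonMetzger2009, Def. 2.2 and Def. 7.1] -/
structure BoundingSurface (h : ContMDiffRiemannianMetric (𝓡 3) ∞ E3 (TangentSpace (𝓡 3) : X → Type _))
    (Ω : Set X) where
  /-- The surface type (possibly disconnected). -/
  surf : Type
  /-- Topology of the surface. -/
  [top : TopologicalSpace surf]
  /-- The surface is a `2`-manifold without boundary. -/
  [charted : ChartedSpace (EuclideanSpace ℝ (Fin 2)) surf]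
  /-- The surface is a smooth manifold. -/
  [mfd : IsManifold (𝓡 2) ∞ surf]
  /-- The surface is compact. -/
  [compact : CompactSpace surf]
  /-- The surface is Hausdorff. -/
  [t2 : T2Space surf]
  /-- Measurable structure of the surface (for its area). -/
  [meas : MeasurableSpace surf]
  /-- The measurable structure is the Borel one. -/
  [borel : BorelSpace surf]
  /-- Smoothness of pullbacks of bilinear forms to `surf` (named fact of `Isometry.lean`). -/
  hpb : contMDiff_pullbackBilin (𝓡 3) X (𝓡 2) surf ∞
  /-- The map of the surface into `X`. -/
  f : surf → X
  /-- The outward unit normal along `f`. -/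
  ν : NormalField (𝓡 3) f
  /-- `f` is a spacelike (Riemannian) immersion into `(X, h)`. -/
  isSpacelikeImmersion : (ofRiemannian h).IsSpacelikeImmersion (𝓡 2) f
  /-- `f` is a smooth embedding. -/
  isEmbedding : Manifold.IsSmoothEmbedding (𝓡 2) (𝓡 3) ∞ f
  /-- `ν` is a unit normal: `h(ν, ν) = 1`, `ν ⊥ df`. -/
  isUnitNormal : (ofRiemannian h).IsUnitNormal (𝓡 2) f ν 1
  /-- `ν` is smooth as a map into the tangent bundle `TX`. -/
  contMDiff_normal :
    ContMDiff (𝓡 2) (𝓡 3).tangent ∞ (fun y ↦ (TotalSpace.mk' E3 (f y) (ν y) : TangentBundle (𝓡 3) X))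
  /-- The inside region is open. -/
  isOpen_inside : IsOpen Ω
  /-- The inside region is precompact. -/
  isCompact_closure_inside : IsCompact (closure Ω)
  /-- The surface is the topological boundary of the inside region. -/
  frontier_inside : frontier Ω = range f
  /-- `ν` points out of `Ω`: the chart-straight curve through `f y` with velocity `ν y` lies
  outside `closure Ω` for small `t > 0`. -/
  pointsOutward (y : surf) :
    ∀ᶠ t in 𝓝[>] (0 : ℝ), curveThrough (𝓡 3) (f y) (ν y) t ∈ (closure Ω)ᶜ

namespace BoundingSurface

attribute [instance] top charted mfd compact t2 meas borel

variable {h : ContMDiffRiemannianMetric (𝓡 3) ∞ E3 (TangentSpace (𝓡 3) : X → Type _)} {Ω : Set X}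

/-- The image of a bounding surface is compact. [folklore] -/
lemma isCompact_range (S : BoundingSurface h Ω) : IsCompact (range S.f) :=
  _root_.isCompact_range S.isEmbedding.isEmbedding.continuous

/-- The image of a bounding surface lies in the closure of its inside (it is its frontier).
Andersson–Metzger 2009, Def. 2.2. [cite: AnderssonMetzger2009, Def. 2.2] -/
lemma range_subset_closure (S : BoundingSurface h Ω) : range S.f ⊆ closure Ω := by
  rw [← S.frontier_inside]
  exact frontier_subset_closure

/-- The image of a bounding surface is disjoint from its (open) inside.
Andersson–Metzger 2009, Def. 2.2. [cite: AnderssonMetzger2009, Def. 2.2] -/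
lemma disjoint_range_inside (S : BoundingSurface h Ω) : Disjoint (range S.f) Ω := by
  rw [← S.frontier_inside]
  exact disjoint_frontier_iff_isOpen.mpr S.isOpen_inside

/-- The *induced Riemannian metric* `f^* h` on a bounding surface. [folklore] -/
def inducedMetric (S : BoundingSurface h Ω) :
    ContMDiffRiemannianMetric (𝓡 2) ∞ (EuclideanSpace ℝ (Fin 2)) (TangentSpace (𝓡 2) : S.surf → _) :=
  (ofRiemannian h).inducedRiemannianMetric S.f S.hpb S.isSpacelikeImmersion

/-- The **area** `|S| = ∫_S dA_{f^* h}` of a bounding surface (`totalArea` of `Volume.lean`: the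
`2`-dimensional Euclidean-normalised Hausdorff measure of the length metric of `f^* h`).
Andersson–Metzger 2009, §1 (area of horizons). [cite: AnderssonMetzger2009, §1] -/
def surfaceArea (S : BoundingSurface h Ω) : ℝ≥0∞ :=
  totalArea S.inducedMetric

/-- The **(irreducible) mass** `m_S := √(|S| / 16π)` of a bounding surface — the mass of the
Schwarzschild horizon of the same area (`|S| = 4π (2m)²`); the quantity of the Penrose inequality
and the `m_S` of formation events. Infinite area is sent to the junk value `0` by `toReal`.
Andersson–Metzger 2009, §1; Bray 2001, Thm. 1 (`m ≥ √(A/16π)`). [cite: AnderssonMetzger2009, §1] -/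
def mass (S : BoundingSurface h Ω) : ℝ :=
  Real.sqrt (S.surfaceArea.toReal / (16 * π))

/-- The mass of a bounding surface is nonnegative. [folklore] -/
lemma mass_nonneg (S : BoundingSurface h Ω) : 0 ≤ S.mass :=
  Real.sqrt_nonneg _

/-- A bounding surface of area `16π` has unit mass (`√(16π/16π) = 1`): the normalisation "unit
black hole" of ancient-in-scale formations. [folklore] -/
lemma mass_eq_one_of_surfaceArea_eq (S : BoundingSurface h Ω)
    (hS : S.surfaceArea = ENNReal.ofReal (16 * π)) : S.mass = 1 := by
  have hπ : (0 : ℝ) < 16 * π := by positivity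
  rw [mass, hS, ENNReal.toReal_ofReal hπ.le, div_self hπ.ne', Real.sqrt_one]

end BoundingSurface

section Trapped

variable (h : ContMDiffRiemannianMetric (𝓡 3) ∞ E3 (TangentSpace (𝓡 3) : X → Type _))
  (k : Π x : X, TangentSpace (𝓡 3) x →L[ℝ] TangentSpace (𝓡 3) x →L[ℝ] ℝ)

/-- The open precompact region `Ω ⊆ X` is a **weakly outer trapped set** of the data `(X, h, k)`:
it is bounded by a compact smoothly embedded surface (`BoundingSurface h Ω`) whose outer null
expansion with respect to the normal pointing OUT of `Ω` is nonpositive, `θ⁺ = tr_S k + H ≤ 0`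
(`IsWeaklyOuterTrapped` of `TrappedSurface.lean`, conventions (h) there; the standing Levi-Civita
hypothesis of `h`, which holds outright — `PseudoRiemannianMetric.hasLeviCivita` — is bound
innermost, as in `DataEmbedding.IsVacuum`). Andersson–Metzger, CMP 290 (2009), Def. 7.1 (there on
a compact `M` with `∂Ω = ∂⁻M ∪ ∂⁺Ω`; here `∂⁻M = ∅` and bounding w.r.t. the outer barrier is
replaced by precompactness, see the module docstring). [cite: AnderssonMetzger2009, Def. 7.1] -/
def IsWeaklyOuterTrappedSet (Ω : Set X) : Prop :=
  ∃ S : BoundingSurface h Ω, ∀ [(ofRiemannian h).HasLeviCivita],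
    IsWeaklyOuterTrapped h k S.f S.hpb S.isSpacelikeImmersion S.ν

/-- The **trapped region** `T ⊆ X` of the data `(X, h, k)`: the union of all weakly outer
trapped sets (Andersson–Metzger, CMP 290 (2009), Def. 7.2, "the weakly outer trapped region …
henceforth simply the trapped region"). By their Thm. 7.3 (under an outer barrier condition) its
boundary is a smooth embedded stable MOTS — the *outermost MOTS* of the data — a theorem, not part
of this definition. [cite: AnderssonMetzger2009, Def. 7.2] -/
def trappedRegion : Set X :=
  ⋃₀ {Ω | IsWeaklyOuterTrappedSet h k Ω}

variable {h k}

/-- Unfolding lemma for `trappedRegion`. [folklore] -/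
lemma mem_trappedRegion_iff {x : X} :
    x ∈ trappedRegion h k ↔ ∃ Ω, IsWeaklyOuterTrappedSet h k Ω ∧ x ∈ Ω :=
  mem_sUnion

/-- A weakly outer trapped set lies in the trapped region. Andersson–Metzger 2009, Def. 7.2.
[cite: AnderssonMetzger2009, Def. 7.2] -/
lemma IsWeaklyOuterTrappedSet.subset_trappedRegion {Ω : Set X}
    (hΩ : IsWeaklyOuterTrappedSet h k Ω) : Ω ⊆ trappedRegion h k :=
  subset_sUnion_of_mem hΩ

/-- The trapped region is open (a union of open sets). Andersson–Metzger 2009, Def. 7.2.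
[cite: AnderssonMetzger2009, Def. 7.2] -/
lemma isOpen_trappedRegion : IsOpen (trappedRegion h k) :=
  isOpen_sUnion fun _ ⟨S, _⟩ ↦ S.isOpen_inside

variable (h k)

/-- A **MOTS bounding an inside region** in the data `(X, h, k)`: an open precompact region
`inside`, a bounding surface of it with smooth outward unit normal (`BoundingSurface`), and the
MOTS condition `θ⁺ = tr_S k + H = 0` for that normal (`IsMOTSInData`, Levi-Civita hypothesis of `h`
bound innermost). Andersson–Metzger, CMP 290
(2009), Def. 2.1 ("a smooth, embedded, compact, two-sided surface is a MOTS if `θ⁺ = 0`") and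
Def. 2.2 (bounding; "the normal pointing into" the outer region "will be used as the outer normal").
[cite: AnderssonMetzger2009, Def. 2.1–2.2] -/
structure BoundingMOTS where
  /-- The open precompact region enclosed by the MOTS. -/
  inside : Set X
  /-- The MOTS as the boundary of its inside, with smooth outward unit normal. -/
  boundary : BoundingSurface h inside
  /-- The MOTS condition `θ⁺ = 0` for the outward normal. -/
  isMOTS : ∀ [(ofRiemannian h).HasLeviCivita],
    IsMOTSInData h k boundary.f boundary.hpb boundary.isSpacelikeImmersion boundary.ν

namespace BoundingMOTS

variable {h k}

/-- The inside of a bounding MOTS is a weakly outer trapped set (`θ⁺ = 0 ≤ 0`).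
Andersson–Metzger 2009, Def. 7.1. [cite: AnderssonMetzger2009, Def. 7.1] -/
lemma isWeaklyOuterTrappedSet_inside (S : BoundingMOTS h k) : IsWeaklyOuterTrappedSet h k S.inside :=
  ⟨S.boundary, S.isMOTS.isWeaklyOuterTrapped⟩

/-- The inside of a bounding MOTS lies in the trapped region. Andersson–Metzger 2009, Def. 7.2.
[cite: AnderssonMetzger2009, Def. 7.2] -/
lemma inside_subset_trappedRegion (S : BoundingMOTS h k) : S.inside ⊆ trappedRegion h k :=
  S.isWeaklyOuterTrappedSet_inside.subset_trappedRegion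

/-- A bounding MOTS lies in the closure of the trapped region. Andersson–Metzger 2009, §7.
[cite: AnderssonMetzger2009, §7] -/
lemma range_subset_closure_trappedRegion (S : BoundingMOTS h k) :
    range S.boundary.f ⊆ closure (trappedRegion h k) :=
  S.boundary.range_subset_closure.trans (closure_mono S.inside_subset_trappedRegion)

/-- The area `|S|` of a bounding MOTS. Andersson–Metzger 2009, §1. [cite: AnderssonMetzger2009, §1] -/
abbrev surfaceArea (S : BoundingMOTS h k) : ℝ≥0∞ :=
  S.boundary.surfaceArea

/-- The mass `m_S = √(|S|/16π)` of a bounding MOTS. Andersson–Metzger 2009, §1.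
[cite: AnderssonMetzger2009, §1] -/
abbrev mass (S : BoundingMOTS h k) : ℝ :=
  S.boundary.mass

end BoundingMOTS

/-- The **formation depth** `h(S) := log (L / m_S)` of the bounding MOTS `S` relative to an
ambient strong-field scale `L > 0` of the datum (card *small-holes-have-critical-ancestry*, D1 (2):
`L` is e.g. the harmonic-radius scale of the ball to which the fall-off confines the strong field;
it is a PARAMETER here — any two reasonable choices differ by a datum-dependent factor, which only
shifts the depth by a datum-dependent constant). Deep events (`h(S) → ∞`) are holes of vanishing
mass `m_S / L → 0`. Junk value `log` of a nonpositive number if `m_S = 0`. The analogue of the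
logarithmic scale of a surgery in Perelman, arXiv:math/0211159, §11–12. [folklore] -/
def formationDepth (L : ℝ) (S : BoundingMOTS h k) : ℝ :=
  Real.log (L / S.mass)

variable {h k} in
/-- Unfolding lemma for `formationDepth`. [folklore] -/
lemma formationDepth_eq (L : ℝ) (S : BoundingMOTS h k) :
    formationDepth h k L S = Real.log (L / S.mass) :=
  rfl

variable {h k} in
/-- For a MOTS of positive mass, `h(S) = log L − log m_S`. [folklore] -/
lemma formationDepth_eq_sub {L : ℝ} (hL : 0 < L) (S : BoundingMOTS h k) (hS : 0 < S.mass) :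
    formationDepth h k L S = Real.log L - Real.log S.mass :=
  Real.log_div hL.ne' hS.ne'

end Trapped

end Data

/-! ### Spacetime side: Cauchy leaves with their data; Cauchy time functions -/

section Leaves

variable (𝓢 : Spacetime.{u} 4)

/-- A **Cauchy leaf** of the spacetime `𝓢 = (M, g, τ)` presented with its induced data: a
connected `3`-manifold `slice` carrying an initial data set `data = (h, k)`, smoothly embedded by
`ι = embed` with future
unit normal `ν`, inducing `ι^* g = h` and `K_ν = k` (sign convention `K_ν(v, w) = + g(D_v ν, dι w)`,
Levi-Civita hypothesis of `g` bound innermost as in `DataEmbedding.induced_k`), and whose image is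
a Cauchy hypersurface (`LorentzianMetric.IsCauchyHypersurface`, O'Neill's Def. 14.28). These are
literally the fields of `CauchyDevelopment` (Ringström 2009, Def. 16.2) with the roles of
parameter and field exchanged: the spacetime is fixed and the data vary (conversions
`toCauchyDevelopment`, `ofCauchyDevelopment`). [cite: Ringstrom2009, Def. 16.2] -/
structure CauchyLeaf where
  /-- The abstract `3`-manifold of the leaf. -/
  slice : Type u
  /-- Topology of the leaf. -/
  [top : TopologicalSpace slice]
  /-- The leaf is a `3`-manifold. -/
  [charted : ChartedSpace E3 slice]
  /-- The leaf is a smooth manifold. -/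
  [mfd : IsManifold (𝓡 3) ∞ slice]
  /-- The leaf is connected. -/
  [connected : ConnectedSpace slice]
  /-- The induced data `(h, k)` on the leaf. -/
  data : InitialDataSet (𝓡 3) slice
  /-- The embedding `ι : slice → M`. -/
  embed : slice → 𝓢.carrier
  /-- `ι` is a smooth embedding. -/
  isSmoothEmbedding : Manifold.IsSmoothEmbedding (𝓡 3) (𝓡 4) ∞ embed
  /-- The future unit normal along `ι`. -/
  normal : NormalField (𝓡 4) embed
  /-- `ν` is the future-directed unit timelike normal of `ι`. -/
  isFutureUnitNormal : 𝓢.metric.IsFutureUnitNormal (𝓡 3) 𝓢.timeOrientation embed normal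
  /-- The induced metric is the data metric: `ι^* g = h`. -/
  induced_h : ∀ y : slice,
    pullbackBilin (I := 𝓡 4) (I' := 𝓡 3) embed 𝓢.metric.val y = data.h.inner y
  /-- The second fundamental form of `ι` w.r.t. `ν` is the data tensor: `K_ν = k`. -/
  induced_k : ∀ [𝓢.metric.toPseudoRiemannianMetric.HasLeviCivita] (y : slice),
    𝓢.metric.toPseudoRiemannianMetric.secondFundamentalForm (𝓡 3) embed normal y = data.kBilin y
  /-- The image `ι(slice)` is a Cauchy hypersurface of `(M, g, τ)`. -/
  isCauchyHypersurface : 𝓢.metric.IsCauchyHypersurface 𝓢.timeOrientation (range embed)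

namespace CauchyLeaf

attribute [instance] top charted mfd connected

variable {𝓢}

/-- A Cauchy leaf of `𝓢` is a Cauchy development of its own data, with spacetime `𝓢`.
Ringström 2009, Def. 16.2. [cite: Ringstrom2009, Def. 16.2] -/
def toCauchyDevelopment (L : CauchyLeaf 𝓢) : CauchyDevelopment L.data where
  toSpacetime := 𝓢
  embed := L.embed
  isSmoothEmbedding := L.isSmoothEmbedding
  normal := L.normal
  isFutureUnitNormal := L.isFutureUnitNormal
  induced_h := L.induced_h
  induced_k := L.induced_k
  isCauchyHypersurface := L.isCauchyHypersurface

/-- The spacetime of the development of a leaf is the ambient spacetime (by `rfl`): the rendering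
"`𝒟'.toSpacetime = 𝒟.toSpacetime`" of a Cauchy slice. [folklore] -/
@[simp]
lemma toCauchyDevelopment_toSpacetime (L : CauchyLeaf 𝓢) : L.toCauchyDevelopment.toSpacetime = 𝓢 :=
  rfl

/-- The development of a leaf has the leaf's embedding (by `rfl`). [folklore] -/
@[simp]
lemma toCauchyDevelopment_embed (L : CauchyLeaf 𝓢) : L.toCauchyDevelopment.embed = L.embed :=
  rfl

/-- Conversely, a Cauchy development `𝒟` of data `D` on `X` is a Cauchy leaf of its own spacetime.
Ringström 2009, Def. 16.2. [cite: Ringstrom2009, Def. 16.2] -/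
def ofCauchyDevelopment {X : Type u} [TopologicalSpace X] [ChartedSpace E3 X]
    [IsManifold (𝓡 3) ∞ X] [ConnectedSpace X] {D : InitialDataSet (𝓡 3) X}
    (𝒟 : CauchyDevelopment D) : CauchyLeaf 𝒟.toSpacetime where
  slice := X
  data := D
  embed := 𝒟.embed
  isSmoothEmbedding := 𝒟.isSmoothEmbedding
  normal := 𝒟.normal
  isFutureUnitNormal := 𝒟.isFutureUnitNormal
  induced_h := 𝒟.induced_h
  induced_k := 𝒟.induced_k
  isCauchyHypersurface := 𝒟.isCauchyHypersurface

/-- `ofCauchyDevelopment` keeps the embedding (by `rfl`). [folklore] -/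
@[simp]
lemma ofCauchyDevelopment_embed {X : Type u} [TopologicalSpace X] [ChartedSpace E3 X]
    [IsManifold (𝓡 3) ∞ X] [ConnectedSpace X] {D : InitialDataSet (𝓡 3) X}
    (𝒟 : CauchyDevelopment D) :
    (ofCauchyDevelopment 𝒟).embed = 𝒟.embed :=
  rfl

/-- The **trapped region of a leaf**, as a subset of spacetime: the image under `ι` of the
trapped region of the leaf's data. Andersson–Metzger 2009, Def. 7.2. [cite: AnderssonMetzger2009, Def. 7.2] -/
def trappedImage (L : CauchyLeaf 𝓢) : Set 𝓢.carrier :=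
  L.embed '' trappedRegion L.data.h L.data.k

end CauchyLeaf

/-- A (smooth) **Cauchy time function** on the spacetime `𝓢 = (M, g, τ)`, with its leaves: a
smooth function `T : M → ℝ` which increases strictly along every future-directed causal curve
(`T(γ a) < T(γ b)` for a causal curve `γ` on `[a, b]`, `a < b`) and each of whose level sets
`{T = t}`, `t ∈ ℝ`, is a Cauchy hypersurface, presented as a Cauchy leaf `leaf t` with its induced
data (`range (leaf t).embed = T⁻¹{t}`; in particular `T` is onto). Bernal–Sánchez, Lett. Math.
Phys. 77 (2006), §2: "A time function is a continuous function `t` which increases strictly on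
any future-directed causal curve … Time and temporal functions will be called Cauchy if their
levels are Cauchy hypersurfaces … (these functions will be assumed onto without loss of
generality)"; by their Thm. 1.2 every spacelike Cauchy hypersurface of a globally hyperbolic
spacetime is a level of a (smooth, even temporal) Cauchy time function. The timelike-gradient
("temporal") condition is not imposed. [cite: BernalSanchez2006, §2 and Thm. 1.2] -/
structure CauchyTimeFunction where
  /-- The time function `T : M → ℝ`. -/
  time : 𝓢.carrier → ℝ
  /-- `T` is smooth. -/
  contMDiff : ContMDiff (𝓡 4) 𝓘(ℝ, ℝ) ∞ time
  /-- `T` increases strictly along future-directed causal curves. -/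
  time_lt_of_isFutureCausalCurveOn : ∀ (γ : ℝ → 𝓢.carrier) (a b : ℝ), a < b →
    𝓢.metric.IsFutureCausalCurveOn 𝓢.timeOrientation γ (Icc a b) → time (γ a) < time (γ b)
  /-- The level `{T = t}` presented as a Cauchy leaf with its induced data. -/
  leaf : ℝ → CauchyLeaf 𝓢
  /-- The leaf `leaf t` is embedded onto the level set `{T = t}`. -/
  range_embed (t : ℝ) : range (leaf t).embed = time ⁻¹' {t}

namespace CauchyTimeFunction

variable {𝓢}

/-- Points of the leaf `leaf t` have time `t`. Bernal–Sánchez 2006, §2. [cite: BernalSanchez2006, §2] -/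
@[simp]
lemma time_embed (T : CauchyTimeFunction 𝓢) (t : ℝ) (y : (T.leaf t).slice) :
    T.time ((T.leaf t).embed y) = t := by
  have hy : (T.leaf t).embed y ∈ T.time ⁻¹' {t} := T.range_embed t ▸ mem_range_self y
  simpa using hy

/-- A Cauchy time function is onto `ℝ` (every level is a nonempty leaf). Bernal–Sánchez 2006, §2
("assumed onto without loss of generality"). [cite: BernalSanchez2006, §2] -/
lemma time_surjective (T : CauchyTimeFunction 𝓢) : Function.Surjective T.time := fun t ↦ by
  obtain ⟨y⟩ := (inferInstance : Nonempty (T.leaf t).slice)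
  exact ⟨(T.leaf t).embed y, T.time_embed t y⟩

/-- Distinct leaves are disjoint. Bernal–Sánchez 2006, §2. [cite: BernalSanchez2006, §2] -/
lemma disjoint_range_embed (T : CauchyTimeFunction 𝓢) {s t : ℝ} (hst : s ≠ t) :
    Disjoint (range (T.leaf s).embed) (range (T.leaf t).embed) := by
  rw [T.range_embed, T.range_embed]
  exact Disjoint.preimage _ (disjoint_singleton.mpr hst)

/-- No future-directed causal curve runs inside a leaf, nor from a later leaf to an earlier one:
along a causal curve on `[a, b]`, `a < b`, the leaf times increase strictly.
Bernal–Sánchez 2006, §2. [cite: BernalSanchez2006, §2] -/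
lemma time_lt (T : CauchyTimeFunction 𝓢) {γ : ℝ → 𝓢.carrier} {a b : ℝ} (hab : a < b)
    (hγ : 𝓢.metric.IsFutureCausalCurveOn 𝓢.timeOrientation γ (Icc a b)) :
    T.time (γ a) < T.time (γ b) :=
  T.time_lt_of_isFutureCausalCurveOn γ a b hab hγ

end CauchyTimeFunction

end Leaves

/-! ### Formation events -/

section Formation

variable {𝓢 : Spacetime.{u} 4}

/-- **Formation event** (card *small-holes-have-critical-ancestry*, D1 (1)): along the Cauchy
time function `T` of the spacetime `𝓢`, the bounding MOTS `S` of the leaf `{T = t₀}` (a MOTS of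
the leaf's induced data `(h, k)`, `BoundingMOTS`) is a NEWLY BORN COMPONENT OF THE OUTERMOST MOTS:

* `S` is connected;
* `S` lies in the boundary of the trapped region of its leaf (`trappedRegion`, Andersson–Metzger
  2009, Def. 7.2, whose boundary is the outermost MOTS, Thm. 7.3; since `S` always lies in the
  closure of the trapped region, this says that `S` meets no weakly outer trapped set of its leaf,
  i.e. is not enclosed — it is outermost);
* BIRTH, continuity form: the image of `S` in spacetime does not meet the closure of the trapped
  world-region `⋃_{t < t₀} ι_t(T_t)` swept out by the trapped regions of the earlier leaves;
* BIRTH, causal form (the card's clause): the image of `S` does not meet the causal future `J⁺`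
  of the trapped region of any earlier leaf.

*Why two birth clauses.* Under the null energy condition the card's causal clause holds for
EVERY outermost MOTS of every leaf: by Andersson–Mars–Metzger–Simon, CQG 26 (2009) 085018,
Thm. 3.1, `J⁺(T_t) ∩ Σ_{t₀} ⊆ T_{t₀}` for `t < t₀` (Raychaudhuri along the outgoing null
hypersurface from the earlier outermost MOTS; "if the `∂⁺T_t` form a smooth MOTT, then this MOTT
is achronal"), and `S ⊆ ∂T_{t₀}` misses the open `T_{t₀}`. So that clause cannot tell a newborn
component from the continuation of a horizon; it is kept as the card states it, and the operative
clause is the continuity one: the trapped regions of the earlier leaves must not accumulate on `S`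
(along a continuous outermost tube `T_t`, `t ↑ t₀`, accumulates on `∂T_{t₀} ⊇ S`), whereas a
component appearing at `t₀` away from all earlier trapped regions — around a new centre the first
weakly outer trapped set appears with finite size, as the first inside region whose boundary
attains `θ⁺ ≤ 0` — satisfies it, as do the targets of outward jumps of the outermost MOTS
(coalescence, AMMS 2009, §4–§6; they enclose MORE area than before and are harmless for counting
small holes). The notion depends on the foliation `T`, as in the card. Its mass is
`S.mass = √(|S|/16π)`, its depth `formationDepth`. A posited notion of the card (no printed source);
ingredients as cited. [cite: AnderssonMetzger2009, Def. 7.2 and Thm. 7.3]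
[cite: AnderssonMarsMetzgerSimon2009, Thm. 3.1] -/
structure IsFormationEvent (T : CauchyTimeFunction 𝓢) (t₀ : ℝ)
    (S : BoundingMOTS (T.leaf t₀).data.h (T.leaf t₀).data.k) : Prop where
  /-- The newborn component is connected. -/
  connected : ConnectedSpace S.boundary.surf
  /-- `S` is a boundary component of the trapped region of its leaf (outermost). -/
  range_subset_frontier :
    range S.boundary.f ⊆ frontier (trappedRegion (T.leaf t₀).data.h (T.leaf t₀).data.k)
  /-- Birth, continuity form: `S` does not meet the closure of the earlier trapped world-region. -/
  disjoint_closure_trappedImage :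
    Disjoint ((T.leaf t₀).embed '' range S.boundary.f)
      (closure (⋃ (t : ℝ) (_ : t < t₀), (T.leaf t).trappedImage))
  /-- Birth, causal form (the card's clause; automatic under NEC, AMMS 2009 Thm. 3.1): `S` does
  not meet `J⁺` of the trapped region of any earlier leaf. -/
  disjoint_causalFuture : ∀ t < t₀,
    Disjoint ((T.leaf t₀).embed '' range S.boundary.f)
      (𝓢.metric.causalFuture 𝓢.timeOrientation (T.leaf t).trappedImage)

namespace IsFormationEvent

variable {T : CauchyTimeFunction 𝓢} {t₀ : ℝ}
  {S : BoundingMOTS (T.leaf t₀).data.h (T.leaf t₀).data.k}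

/-- A formation event meets no weakly outer trapped set of its own leaf (it is outermost): its
image is disjoint from the (open) trapped region. Andersson–Metzger 2009, Def. 2.3 and Thm. 7.3.
[cite: AnderssonMetzger2009, Def. 2.3 and Thm. 7.3] -/
lemma disjoint_range_trappedRegion (hS : IsFormationEvent T t₀ S) :
    Disjoint (range S.boundary.f) (trappedRegion (T.leaf t₀).data.h (T.leaf t₀).data.k) :=
  Set.disjoint_of_subset_left hS.range_subset_frontier
    (disjoint_frontier_iff_isOpen.mpr isOpen_trappedRegion)

/-- In particular a formation event does not meet the trapped region of any earlier leaf itself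
(`T_t ⊆ J⁺(T_t)`, or `T_t ⊆ closure ⋃_{s<t₀} T_s`). [folklore] -/
lemma disjoint_trappedImage (hS : IsFormationEvent T t₀ S) {t : ℝ} (ht : t < t₀) :
    Disjoint ((T.leaf t₀).embed '' range S.boundary.f) (T.leaf t).trappedImage :=
  Set.disjoint_of_subset_right (LorentzianMetric.subset_causalFuture _ _ _)
    (hS.disjoint_causalFuture t ht)

/-- The earlier trapped world-region itself (not only its closure) misses a formation event.
[folklore] -/
lemma disjoint_iUnion_trappedImage (hS : IsFormationEvent T t₀ S) :
    Disjoint ((T.leaf t₀).embed '' range S.boundary.f)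
      (⋃ (t : ℝ) (_ : t < t₀), (T.leaf t).trappedImage) :=
  Set.disjoint_of_subset_right subset_closure hS.disjoint_closure_trappedImage

end IsFormationEvent

end Formation

/-! ### Ancient-in-scale formations -/

section Ancient

/-! #### The scale-invariant size of the `m`-th derivatives -/

section DerivSup

variable {F G : Type*} [NormedAddCommGroup F] [NormedSpace ℝ F] [NormedAddCommGroup G]
  [NormedSpace ℝ G]

/-- The **scale-invariant sup of the `m`-th derivatives** of `f : F → G` over `U ⊆ F`:
`sup_{x ∈ U} (1 + ‖x‖)^m ‖D^m f (x)‖ ∈ [0, ∞]` — the order-`m` part of the weighted seminorm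
`weightedCkSeminorm U k 0 f` of `WeightedNorms.lean` (`weightedDerivSup_le_weightedCkSeminorm`),
singled out because non-smallness is measured by first derivatives alone (`m = 1`: the size of the
connection coefficients at the scale of the point). Christodoulou–Klainerman 1993, §1, (1.0.9)
(weighted norms); Bartnik 1986, (1.3). [cite: ChristodoulouKlainerman1993, §1] -/
def weightedDerivSup (U : Set F) (m : ℕ) (f : F → G) : ℝ≥0∞ :=
  ⨆ x ∈ U, ENNReal.ofReal ((1 + ‖x‖) ^ m * ‖iteratedFDeriv ℝ m f x‖)

/-- Over the empty set the scale-invariant sup vanishes. [folklore] -/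
@[simp]
lemma weightedDerivSup_empty (m : ℕ) (f : F → G) : weightedDerivSup (∅ : Set F) m f = 0 := by
  simp [weightedDerivSup]

/-- The scale-invariant sup is monotone in the set. [folklore] -/
lemma weightedDerivSup_mono {U V : Set F} (h : U ⊆ V) (m : ℕ) (f : F → G) :
    weightedDerivSup U m f ≤ weightedDerivSup V m f :=
  iSup_le_iSup_of_subset h

/-- Pointwise bound: `(1 + ‖x‖)^m ‖D^m f(x)‖ ≤ weightedDerivSup U m f` for `x ∈ U`. [folklore] -/
lemma ofReal_le_weightedDerivSup {U : Set F} {x : F} (hx : x ∈ U) (m : ℕ) (f : F → G) :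
    ENNReal.ofReal ((1 + ‖x‖) ^ m * ‖iteratedFDeriv ℝ m f x‖) ≤ weightedDerivSup U m f :=
  le_iSup₂_of_le x hx le_rfl

/-- The order-`m` part is dominated by the weighted `C^k_0` seminorm for `m ≤ k`
(Bartnik 1986, (1.3)). [cite: Bartnik1986, (1.3)] -/
lemma weightedDerivSup_le_weightedCkSeminorm (U : Set F) {m k : ℕ} (hm : m ≤ k) (f : F → G) :
    weightedDerivSup U m f ≤ weightedCkSeminorm U k 0 f := by
  refine le_iSup₂_of_le m hm (iSup₂_mono fun x _ ↦ le_of_eq ?_)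
  rw [zero_add, Real.rpow_natCast]

end DerivSup

/-- The data `(𝓜, ḡ, S̄, gauge)` of a would-be **ancient-in-scale formation** (card
*small-holes-have-critical-ancestry*, D1 (3)): a spacetime `𝓜 = spacetime` (in general NOT
asymptotically flat) with a Cauchy time function `foliation` (its leaves are the foliation part of
the gauge), a MOTS `hole = S̄` of the leaf `{T = 0}` bounding an inside region (`BoundingMOTS`),
and a coordinate chart `chart = Ψ : domain → 𝓜` on an open `domain ⊆ E4 = ℝ⁴` (the chart part of
the gauge, in which scales are measured). No conditions yet: see `IsAncientInScaleFormationWith`.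
A posited object of the card; template: Perelman's ancient `κ`-solutions, arXiv:math/0211159,
§11. [folklore] -/
structure FormationGerm where
  /-- The spacetime `(𝓜, ḡ, τ)`. -/
  spacetime : Spacetime.{u} 4
  /-- The Cauchy time function (foliation gauge), with its leaves. -/
  foliation : CauchyTimeFunction spacetime
  /-- The black hole: a MOTS of the leaf `{T = 0}` bounding an inside region. -/
  hole : BoundingMOTS (foliation.leaf 0).data.h (foliation.leaf 0).data.k
  /-- The coordinate domain `U ⊆ E4` of the gauge chart. -/
  domain : Opens E4
  /-- The gauge chart `Ψ : U → 𝓜`. -/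
  chart : domain → spacetime.carrier

namespace FormationGerm

/-- The hole `S̄` as a subset of spacetime: the image of the MOTS under the embedding of the leaf
`{T = 0}`. [folklore] -/
def holeSet (𝓐 : FormationGerm.{u}) : Set 𝓐.spacetime.carrier :=
  (𝓐.foliation.leaf 0).embed '' range 𝓐.hole.boundary.f

/-- The **causal past `J⁻(S̄)`** of the hole — the region an ancient-in-scale formation controls.
O'Neill 1983, Ch. 14, p. 403 (`J⁻`). [cite: ONeill1983, Ch. 14  p. 403] -/
def past (𝓐 : FormationGerm.{u}) : Set 𝓐.spacetime.carrier :=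
  𝓐.spacetime.metric.causalPast 𝓐.spacetime.timeOrientation 𝓐.holeSet

/-- The causal past of the hole read in the gauge chart: `V := Ψ⁻¹(J⁻(S̄)) ⊆ U ⊆ E4`, as a subset
of `E4`. [folklore] -/
def pastCoords (𝓐 : FormationGerm.{u}) : Set E4 :=
  Subtype.val '' (𝓐.chart ⁻¹' 𝓐.past)

/-- The Minkowski reference background `(U, η, x⁰, |x̲|)` on the chart domain
(`Minkowski.backgroundOn`, `KerrConvergence.lean`). Christodoulou–Klainerman 1993, Thm. 1.0.2.
[cite: ChristodoulouKlainerman1993, Thm. 1.0.2] -/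
def background (𝓐 : FormationGerm.{u}) : ModelBackground :=
  Minkowski.backgroundOn 𝓐.domain

/-- The **pulled-back metric in the chart**, `(Ψ^* ḡ)(x) : E4 →L[ℝ] E4 →L[ℝ] ℝ` at `x ∈ U` (the
tangent space of the open `U ⊆ E4` at `x` is `E4` definitionally). O'Neill 1983, Ch. 3, Def. 3.9
(pullback). [cite: ONeill1983, Ch. 3, Def. 3.9] -/
def chartMetric (𝓐 : FormationGerm.{u}) (x : 𝓐.domain) : E4 →L[ℝ] E4 →L[ℝ] ℝ :=
  show E4 →L[ℝ] E4 →L[ℝ] ℝ from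
    pullbackBilin (I := 𝓡 4) (I' := 𝓘(ℝ, E4)) 𝓐.chart 𝓐.spacetime.metric.val x

/-- The **metric deviation from Minkowski in the chart**, `Ψ^* ḡ − η`, extended by `0` off `U` so
that Mathlib's `iteratedFDeriv`/`fderiv` apply (`Spacetime.deviationExtend` of
`KerrConvergence.lean` for the Minkowski background on `U`). Christodoulou–Klainerman 1993, (1.0.9).
[cite: ChristodoulouKlainerman1993, (1.0.9)] -/
def deviation (𝓐 : FormationGerm.{u}) : E4 → E4 →L[ℝ] E4 →L[ℝ] ℝ :=
  𝓐.spacetime.deviationExtend 𝓐.background 𝓐.chart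

/-- On the chart domain the deviation is `Ψ^* ḡ − η`. Christodoulou–Klainerman 1993, (1.0.9).
[cite: ChristodoulouKlainerman1993, (1.0.9)] -/
lemma deviation_coe (𝓐 : FormationGerm.{u}) (x : 𝓐.domain) :
    𝓐.deviation x = 𝓐.chartMetric x - Minkowski.bilin :=
  𝓐.spacetime.deviationExtend_coe 𝓐.background 𝓐.chart x

/-- The hole lies in its own causal past (`S̄ ⊆ J⁻(S̄)`). O'Neill 1983, Ch. 14, p. 403.
[cite: ONeill1983, Ch. 14  p. 403] -/
lemma holeSet_subset_past (𝓐 : FormationGerm.{u}) : 𝓐.holeSet ⊆ 𝓐.past :=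
  LorentzianMetric.subset_causalPast _ _ _

/-- `pastCoords` lies in the chart domain. [folklore] -/
lemma pastCoords_subset (𝓐 : FormationGerm.{u}) : 𝓐.pastCoords ⊆ (𝓐.domain : Set E4) := by
  rintro _ ⟨x, -, rfl⟩
  exact x.2

end FormationGerm

/-- The **dyadic scale shell** `{x ∈ E4 | ℓ ≤ 1 + ‖x‖ ≤ 2ℓ}` of the gauge chart (scale `ℓ ≥ 1`,
measured from the chart origin by the Euclidean coordinate norm, space and time alike).
Christodoulou–Klainerman 1993, §1 (the weight `(1 + d₀²)^{1/2}`). [folklore] -/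
def scaleShell (ℓ : ℝ) : Set E4 :=
  {x | ℓ ≤ 1 + ‖x‖ ∧ 1 + ‖x‖ ≤ 2 * ℓ}

/-- Membership in a scale shell. [folklore] -/
@[simp]
lemma mem_scaleShell {ℓ : ℝ} {x : E4} : x ∈ scaleShell ℓ ↔ ℓ ≤ 1 + ‖x‖ ∧ 1 + ‖x‖ ≤ 2 * ℓ :=
  Iff.rfl

/-- Every point lies in some scale shell of scale `≥ 1` (take `ℓ = 1 + ‖x‖`). [folklore] -/
lemma mem_scaleShell_one_add_norm (x : E4) : x ∈ scaleShell (1 + ‖x‖) :=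
  ⟨le_rfl, by linarith [norm_nonneg x]⟩

/-- **Ancient-in-scale formation with constants `(k, α, Λ, ε₀)`** (card
*small-holes-have-critical-ancestry*, D1 (3), in chart-level consequence form — see the module
docstring): the germ `𝓐 = (𝓜, ḡ, T, S̄, Ψ)` satisfies

* `𝓜` is VACUUM (`Ric(ḡ) = 0`, Levi-Civita hypothesis bound innermost) and GLOBALLY HYPERBOLIC;
* `S̄` is connected of area `16π` — a UNIT black hole, `m_{S̄} = 1` (`mass_hole`);
* GAUGE: `Ψ : U → 𝓜` is a smooth embedding with open range (a global coordinate system) whose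
  coordinate time `x⁰` is the Cauchy time function `T`, which covers the causal past `J⁻(S̄)`, and
  in which `S̄` lies within coordinate distance `Λ` of the origin (the base point: "pointed");
* UNIFORM NON-DEGENERACY on `V := Ψ⁻¹(J⁻(S̄))`: `(Ψ^*ḡ)(∂₀, ∂₀) ≤ −Λ⁻¹` and
  `(Ψ^*ḡ)(v, v) ≥ Λ⁻¹ ‖v‖²` for spatial `v` (`v⁰ = 0`);
* SCALE-INVARIANT `C^{k,α}` CONTROL on `V` with constants independent of the scale:
  `sup_{m ≤ k} sup_{x ∈ V} (1 + ‖x‖)^m ‖D^m(Ψ^*ḡ − η)(x)‖ ≤ Λ` (`weightedCkSeminorm V k 0`, the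
  weighted `C^k_0` seminorm of `WeightedNorms.lean`) and, for `x, y ∈ V` with
  `‖y − x‖ ≤ (1 + ‖x‖)/2`, `(1 + ‖x‖)^{k+α} ‖D^k(Ψ^*ḡ − η)(y) − D^k(Ψ^*ḡ − η)(x)‖ ≤ Λ ‖y − x‖^α`
  (for `(k, α) = (1, α)` this is a uniform lower bound on the `C^{1,α}`-harmonic-radius-type scale
  `≳ 1 + ‖x‖`; `k = 2` bounds curvature by `(1 + ‖x‖)⁻²`);
* SCALE-INVARIANT NON-SMALLNESS at every scale `ℓ ≥ 1`:
  `sup_{x ∈ V, ℓ ≤ 1+‖x‖ ≤ 2ℓ} (1 + ‖x‖) ‖D(Ψ^*ḡ − η)(x)‖ ≥ ε₀` — the past is not `ε₀`-close to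
  flat at any scale ("small past data make no hole"), so in particular it reaches every scale
  (`exists_mem_pastCoords`).

The class is meant to receive the limits of the rescaled pasts `(J⁻(S_n), m_{S_n}⁻² g)` of formation
events of depth `→ ∞` (card K1) and the blow-up limits along tuned one-parameter families (card
P3); neither existence statement is part of this definition. Ingredients: Klainerman–Rodnianski–
Szeftel 2015, Thm. 2.2 (level of control); Christodoulou–Klainerman 1993, §1 and An–Luk 2017, §1
(scale-invariant smallness / scale-critical norms); Perelman 2002, §11 (template). A posited
notion of the card. [folklore] -/
structure IsAncientInScaleFormationWith (k : ℕ) (α Λ ε₀ : ℝ) (𝓐 : FormationGerm.{u}) : Prop where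
  /-- The control constant is at least `1`. -/
  one_le : 1 ≤ Λ
  /-- The non-smallness constant is positive. -/
  ε₀_pos : 0 < ε₀
  /-- The Hölder exponent lies in `[0, 1]`. -/
  α_nonneg : 0 ≤ α
  /-- The Hölder exponent lies in `[0, 1]`. -/
  α_le_one : α ≤ 1
  /-- Vacuum: `Ric(ḡ) = 0`. -/
  isRicciFlat : ∀ [𝓐.spacetime.metric.toPseudoRiemannianMetric.HasLeviCivita],
    𝓐.spacetime.metric.toPseudoRiemannianMetric.IsRicciFlat
  /-- `𝓜` is globally hyperbolic. -/
  isGloballyHyperbolic :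
    𝓐.spacetime.metric.IsGloballyHyperbolic 𝓐.spacetime.timeOrientation
  /-- The hole is connected. -/
  connected_hole : ConnectedSpace 𝓐.hole.boundary.surf
  /-- Unit black hole: `|S̄| = 16π`. -/
  surfaceArea_hole : 𝓐.hole.surfaceArea = ENNReal.ofReal (16 * π)
  /-- The gauge chart is a smooth embedding … -/
  isSmoothEmbedding_chart : Manifold.IsSmoothEmbedding 𝓘(ℝ, E4) (𝓡 4) ∞ 𝓐.chart
  /-- … with open range (a diffeomorphism onto an open subset of `𝓜`). -/
  isOpen_range_chart : IsOpen (range 𝓐.chart)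
  /-- Coordinate time is the Cauchy time function: `T ∘ Ψ = x⁰`. -/
  time_chart : ∀ x : 𝓐.domain, 𝓐.foliation.time (𝓐.chart x) = x.1 0
  /-- The chart covers the causal past of the hole. -/
  past_subset_range : 𝓐.past ⊆ range 𝓐.chart
  /-- The hole lies within coordinate distance `Λ` of the origin. -/
  norm_le_of_mem_holeSet : ∀ x : 𝓐.domain, 𝓐.chart x ∈ 𝓐.holeSet → ‖x.1‖ ≤ Λ
  /-- `∂₀` is uniformly timelike on the past: `(Ψ^*ḡ)(∂₀, ∂₀) ≤ −Λ⁻¹`. -/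
  chartMetric_basisVector_le : ∀ x : 𝓐.domain, 𝓐.chart x ∈ 𝓐.past →
    𝓐.chartMetric x (E4.basisVector 0) (E4.basisVector 0) ≤ -Λ⁻¹
  /-- Spatial coordinate vectors are uniformly spacelike on the past. -/
  le_chartMetric_of_spatial : ∀ x : 𝓐.domain, 𝓐.chart x ∈ 𝓐.past →
    ∀ v : E4, v 0 = 0 → Λ⁻¹ * ‖v‖ ^ 2 ≤ 𝓐.chartMetric x v v
  /-- Scale-invariant `C^k` control of `Ψ^*ḡ − η` on the past, constant independent of scale. -/
  weightedCkSeminorm_le : weightedCkSeminorm 𝓐.pastCoords k 0 𝓐.deviation ≤ ENNReal.ofReal Λ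
  /-- Scale-invariant local `α`-Hölder control of `D^k(Ψ^*ḡ − η)` on the past. -/
  holder : ∀ x ∈ 𝓐.pastCoords, ∀ y ∈ 𝓐.pastCoords, ‖y - x‖ ≤ (1 + ‖x‖) / 2 →
    (1 + ‖x‖) ^ ((k : ℝ) + α) *
        ‖iteratedFDeriv ℝ k 𝓐.deviation y - iteratedFDeriv ℝ k 𝓐.deviation x‖ ≤
      Λ * ‖y - x‖ ^ α
  /-- Scale-invariant non-smallness of the past on every dyadic shell of scale `ℓ ≥ 1`. -/
  le_weightedDerivSup_shell : ∀ ℓ : ℝ, 1 ≤ ℓ →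
    ENNReal.ofReal ε₀ ≤ weightedDerivSup (𝓐.pastCoords ∩ scaleShell ℓ) 1 𝓐.deviation

/-- **Ancient-in-scale formation** of regularity `C^{k,α}` (card *small-holes-have-critical-
ancestry*, D1 (3)): the germ `𝓐` is an ancient-in-scale formation with SOME constants `Λ ≥ 1`
(control, non-degeneracy, position of the hole) and `ε₀ > 0` (non-smallness at every scale) —
"constants independent of the scale" but depending on the object. See
`IsAncientInScaleFormationWith`. A posited notion of the card. [folklore] -/
def IsAncientInScaleFormation (k : ℕ) (α : ℝ) (𝓐 : FormationGerm.{u}) : Prop :=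
  ∃ Λ ε₀ : ℝ, IsAncientInScaleFormationWith k α Λ ε₀ 𝓐

namespace IsAncientInScaleFormationWith

variable {k : ℕ} {α Λ ε₀ : ℝ} {𝓐 : FormationGerm.{u}}

/-- Forgetting the constants. [folklore] -/
lemma isAncientInScaleFormation (h : IsAncientInScaleFormationWith k α Λ ε₀ 𝓐) :
    IsAncientInScaleFormation k α 𝓐 :=
  ⟨Λ, ε₀, h⟩

/-- The control constant is positive. [folklore] -/
lemma pos (h : IsAncientInScaleFormationWith k α Λ ε₀ 𝓐) : 0 < Λ :=
  one_pos.trans_le h.one_le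

/-- The hole of an ancient-in-scale formation is a unit black hole: `m_{S̄} = √(16π/16π) = 1`.
[folklore] -/
lemma mass_hole (h : IsAncientInScaleFormationWith k α Λ ε₀ 𝓐) : 𝓐.hole.mass = 1 :=
  𝓐.hole.boundary.mass_eq_one_of_surfaceArea_eq h.surfaceArea_hole

/-- Consistency of the two functionals: for `k ≥ 1` the non-smallness constant cannot exceed the
control constant, `ε₀ ≤ Λ` (the order-`1` sup over a shell is dominated by the weighted `C^k_0`
seminorm over the whole past). [folklore] -/
lemma ε₀_le (h : IsAncientInScaleFormationWith k α Λ ε₀ 𝓐) (hk : 1 ≤ k) : ε₀ ≤ Λ := by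
  have h1 := h.le_weightedDerivSup_shell 1 le_rfl
  have h2 : weightedDerivSup (𝓐.pastCoords ∩ scaleShell 1) 1 𝓐.deviation ≤ ENNReal.ofReal Λ :=
    ((weightedDerivSup_mono inter_subset_left 1 _).trans
      (weightedDerivSup_le_weightedCkSeminorm _ hk _)).trans h.weightedCkSeminorm_le
  exact (ENNReal.ofReal_le_ofReal_iff h.pos.le).mp (h1.trans h2)

/-- **The past of an ancient-in-scale formation reaches every scale**: for every `ℓ ≥ 1` some
point of `Ψ⁻¹(J⁻(S̄))` lies in the shell `ℓ ≤ 1 + ‖x‖ ≤ 2ℓ` (the non-smallness clause cannot hold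
on an empty shell). This is the sense in which the object is "ancient in scale". [folklore] -/
lemma exists_mem_pastCoords (h : IsAncientInScaleFormationWith k α Λ ε₀ 𝓐) {ℓ : ℝ} (hℓ : 1 ≤ ℓ) :
    ∃ x ∈ 𝓐.pastCoords, ℓ ≤ 1 + ‖x‖ ∧ 1 + ‖x‖ ≤ 2 * ℓ := by
  have hle := h.le_weightedDerivSup_shell ℓ hℓ
  by_contra hne
  have hempty : 𝓐.pastCoords ∩ scaleShell ℓ = ∅ :=
    Set.subset_eq_empty (fun x ⟨hx, hs⟩ ↦ (hne ⟨x, hx, hs.1, hs.2⟩).elim) rfl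
  rw [hempty, weightedDerivSup_empty, nonpos_iff_eq_zero, ENNReal.ofReal_eq_zero] at hle
  exact hle.not_gt h.ε₀_pos

/-- In particular the causal past `J⁻(S̄)` of the hole is unbounded in the chart: it contains
points of arbitrarily large coordinate norm. [folklore] -/
lemma exists_mem_pastCoords_le_norm (h : IsAncientInScaleFormationWith k α Λ ε₀ 𝓐) (R : ℝ) :
    ∃ x ∈ 𝓐.pastCoords, R ≤ ‖x‖ := by
  obtain ⟨x, hx, h1, -⟩ := h.exists_mem_pastCoords (show (1 : ℝ) ≤ max 1 (R + 1) from le_max_left _ _)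
  exact ⟨x, hx, by linarith [le_max_right 1 (R + 1)]⟩

/-- Monotonicity in the constants: weakening `Λ ↦ Λ' ≥ Λ` and `ε₀ ↦ ε₀' ∈ (0, ε₀]` preserves the
class. [folklore] -/
lemma mono (h : IsAncientInScaleFormationWith k α Λ ε₀ 𝓐) {Λ' ε₀' : ℝ} (hΛ : Λ ≤ Λ')
    (hε : ε₀' ≤ ε₀) (hε' : 0 < ε₀') : IsAncientInScaleFormationWith k α Λ' ε₀' 𝓐 where
  one_le := h.one_le.trans hΛ
  ε₀_pos := hε'
  α_nonneg := h.α_nonneg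
  α_le_one := h.α_le_one
  isRicciFlat := h.isRicciFlat
  isGloballyHyperbolic := h.isGloballyHyperbolic
  connected_hole := h.connected_hole
  surfaceArea_hole := h.surfaceArea_hole
  isSmoothEmbedding_chart := h.isSmoothEmbedding_chart
  isOpen_range_chart := h.isOpen_range_chart
  time_chart := h.time_chart
  past_subset_range := h.past_subset_range
  norm_le_of_mem_holeSet x hx := (h.norm_le_of_mem_holeSet x hx).trans hΛ
  chartMetric_basisVector_le x hx :=
    (h.chartMetric_basisVector_le x hx).trans
      (neg_le_neg (inv_anti₀ h.pos hΛ))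
  le_chartMetric_of_spatial x hx v hv :=
    (mul_le_mul_of_nonneg_right (inv_anti₀ h.pos hΛ) (sq_nonneg _)).trans
      (h.le_chartMetric_of_spatial x hx v hv)
  weightedCkSeminorm_le := h.weightedCkSeminorm_le.trans (ENNReal.ofReal_le_ofReal hΛ)
  holder x hx y hy hxy :=
    (h.holder x hx y hy hxy).trans
      (mul_le_mul_of_nonneg_right hΛ (Real.rpow_nonneg (norm_nonneg _) _))
  le_weightedDerivSup_shell ℓ hℓ :=
    (ENNReal.ofReal_le_ofReal hε).trans (h.le_weightedDerivSup_shell ℓ hℓ)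

end IsAncientInScaleFormationWith

end Ancient

end Literature.Geometry.Lorentzian

end
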